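import Summits.AnomalousDissipation.AnomalousDissipation.Theorems.GenericRunawayStokesScaling.Negative.Deriv
import Summits.AnomalousDissipation.AnomalousDissipation.Theorems.GenericRunawayStokesScaling.Negative.ZeroViscosityLine

/-!
# Negative knowledge for the crux `MirrorVariety.GenericRunawayStokesScaling` (stmt-AnomalousDissipation-2990), IV:
# critical points on the `ν = 0` fibre; `g ≠ 0` is implied by regularity

Certified copy of §§8, 10 of the cdisprove work file.  `ne_zero_of_regular`: for `N ≥ 1` the hypothesis `g ≠ 0`
of the crux is implied by regularity (at `g = 0` the origin is a zero with `DF(0,0) = 0`).  `not_regular_gW`: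
the witness force of part III is NOT a regular value — every `DF(W₀,0)(v,t)` has zero `(0,0,2)`-coefficient
while `U₀ ∈ galerkinSubspace` does not.  In general (`derivFun_apply_eq_zero_of_unreachable`,
`not_regular_of_dead_slot`): at a point `(c, 0)` a frequency `k` with `c_k = 0` that no supported frequency of
`c` reaches inside `S` is a DEAD SLOT of `Range DF(c,0)`, so `(c, 0)` is critical — every `ν = 0` line built from
planar/low modes (part III's; the 2½-D shear family `(0, cos 2πx₁, s cos 2πx₁ + sin 2πx₂)` of the route review,
top slot `(0,0,N)` dead at every `N ≥ 2`) is excluded by the crux's hypothesis: any proof must USE regularity,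
and unbounded `ν = 0` fibres of regular forces would need supports reaching every shell.
Supports stmt-AnomalousDissipation-2990.
-/

set_option linter.dupNamespace false

noncomputable section

open scoped BigOperators InnerProductSpace ComplexConjugate
open Filter Set Function

namespace Summit.AnomalousDissipation.AnomalousDissipation.Theorems.GenericRunawayStokesScaling.Negative

open Literature.Analysis.FunctionSpaces Literature.Analysis.FunctionSpaces.Torus
open Literature.Analysis.FluidPDE Literature.Analysis.FluidPDE.Torus
open Summit.AnomalousDissipation.AnomalousDissipation.Theses.MirrorVariety

/-! ## §8 Two consequences: `g ≠ 0` is implied by regularity; the `ν = 0` line of §5 is NOT regular -/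

/-- At `g = 0` the origin `(0, 0)` is a zero of `F`. [folklore] -/
theorem zero_mem_variety_zero (S : Finset (Fin 3 → ℤ)) :
    ((0 : ↥S → (EuclideanSpace ℂ (Fin 3))), (0 : ℝ)) ∈ variety S 0 := by
  refine ⟨(galerkinSubspace S).zero_mem, ?_⟩
  show galerkinRHS S 0 0 0 = 0
  funext k
  simp [galerkinRHS_apply, galerkinField_def]

/-- At `g = 0` the derivative at the origin vanishes identically. [folklore] -/
theorem derivFun_origin (S : Finset (Fin 3 → ℤ)) (h : (↥S → (EuclideanSpace ℂ (Fin 3))) × ℝ) :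
    derivFun S ((0 : ↥S → (EuclideanSpace ℂ (Fin 3))), (0 : ℝ)) h = 0 := by
  simp [derivFun, stokesA_zero, symB_zero_left]

/-- A nonzero element of the Galerkin space: `w_k = Π_k e₀`. [folklore] -/
def wUnit (S : Finset (Fin 3 → ℤ)) : ↥S → (EuclideanSpace ℂ (Fin 3)) := fun k => leraySym (k : Fin 3 → ℤ) aU

/-- `w` lies in the Galerkin space. [folklore] -/
theorem wUnit_mem (S : Finset (Fin 3 → ℤ)) : wUnit S ∈ galerkinSubspace S := by
  refine ⟨?_, ?_⟩
  · intro k l hl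
    simp only [wUnit]
    rw [hl, leraySym_neg_freq, conjVec_leraySym, conjVec_aU]
  · intro k
    exact sum_mul_leraySym_apply _ _

/-- `w ≠ 0` as soon as `(0,1,0) ∈ S_N`, i.e. `N ≥ 1`. [folklore] -/
theorem wUnit_ne_zero {N : ℕ} (hN : 1 ≤ N) : wUnit (PB N) ≠ 0 := by
  have hq : q1 ∈ PB N := by
    refine mem_PB_iff.2 ⟨vec_ne 1 (by simp [q1, Matrix.cons_val_one]), ?_⟩
    have : (1 : ℤ) ≤ (N : ℤ) ^ 2 := by nlinarith
    simpa [q1, Fin.sum_univ_three, Matrix.cons_val_zero, Matrix.cons_val_one, Matrix.cons_val_two,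
      Matrix.head_cons, Matrix.tail_cons] using this
  intro h
  have h1 : wUnit (PB N) ⟨q1, hq⟩ = aU := by
    simp only [wUnit]
    refine leraySym_of_transversal ?_
    simp [q1, aU, Matrix.cons_val_zero]
  have h2 : wUnit (PB N) ⟨q1, hq⟩ = 0 := by rw [h]; rfl
  have h3 : aU = 0 := h1.symm.trans h2
  have : ‖aU‖ = 0 := by rw [h3, norm_zero]
  rw [norm_aU] at this
  exact one_ne_zero this

/-- **`g ≠ 0` is implied by regularity** (`N ≥ 1`): at `g = 0` the origin is a zero of `F` with
`DF(0,0) = 0`, which is not onto the nontrivial Galerkin space.  (So the hypothesis `g ≠ 0` of the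
crux is decoration; at `N = 0` everything is vacuous.) [folklore] -/
theorem ne_zero_of_regular {N : ℕ} (hN : 1 ≤ N) {g : ↥(PB N) → (EuclideanSpace ℂ (Fin 3))} (hreg : Regular (PB N) g) :
    g ≠ 0 := by
  rintro rfl
  rw [regular_iff] at hreg
  obtain ⟨v, _, t, hvt⟩ := hreg _ (zero_mem_variety_zero (PB N)) (wUnit (PB N)) (wUnit_mem (PB N))
  rw [derivFun_origin] at hvt
  exact wUnit_ne_zero hN hvt.symm

/-- Frequencies of `supp W₀` cannot reach `k₀` inside `S_2`: `k₀ - l ∉ S_2` for `l ∈ {±p, ±q}`. -/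
theorem W0_cannot_reach_k0 {l m : Fin 3 → ℤ} (hl : (l = p1 ∨ l = -p1) ∨ (l = q1 ∨ l = -q1))
    (hm : m ∈ PB 2) : l + m ≠ k0 ∧ m + l ≠ k0 := by
  have key : l + m ≠ k0 := by
    intro heq
    have hm' : m = k0 - l := eq_sub_of_add_eq' heq
    rw [hm'] at hm
    revert hm
    rcases hl with (rfl | rfl) | (rfl | rfl) <;>
      exact not_mem_PB_of (Or.inr (by norm_num [k0, p1, q1, Fin.sum_univ_three, Matrix.cons_val_zero,
        Matrix.cons_val_one, Matrix.cons_val_two, Matrix.head_cons, Matrix.tail_cons]))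
  exact ⟨key, by rwa [add_comm]⟩

/-- Nothing interacts with `W₀` into `k₀` (left slot). [folklore] -/
theorem cc_W0_any_k0 (v : ↥(PB 2) → (EuclideanSpace ℂ (Fin 3))) :
    convectionCoeff (PB 2) (coeffExt _ W0) (coeffExt _ v) k0 = 0 :=
  convectionCoeff_eq_zero_of_support fun _ _ _ hm hl _ => (W0_cannot_reach_k0 (supp_W0 hl) hm).1

/-- Nothing interacts with `W₀` into `k₀` (right slot). [folklore] -/
theorem cc_any_W0_k0 (v : ↥(PB 2) → (EuclideanSpace ℂ (Fin 3))) :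
    convectionCoeff (PB 2) (coeffExt _ v) (coeffExt _ W0) k0 = 0 :=
  convectionCoeff_eq_zero_of_support fun _ hl _ _ _ hm => (W0_cannot_reach_k0 (supp_W0 hm) hl).2

/-- `(W₀)_{k₀} = 0`. [folklore] -/
theorem W0_k0 : W0 ⟨k0, k0_mem⟩ = 0 := by
  rw [W0_apply, if_neg, if_neg]
  · exact not_or.2 ⟨vec_ne 1 (by simp [k0, q1, Matrix.cons_val_one]),
      vec_ne 1 (by simp [k0, q1, Matrix.cons_val_one])⟩
  · exact not_or.2 ⟨vec_ne 0 (by simp [k0, p1, Matrix.cons_val_zero]),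
      vec_ne 0 (by simp [k0, p1, Matrix.cons_val_zero])⟩

/-- **The `k₀`-slot of `Range DF(W₀, 0)` is zero**: nothing supported on `S_2` interacts INTO `k₀`
against `W₀`, and `(A W₀)_{k₀} = 0`. -/
theorem derivFun_W0_k0 (h : (↥(PB 2) → (EuclideanSpace ℂ (Fin 3))) × ℝ) : derivFun (PB 2) (W0, (0 : ℝ)) h ⟨k0, k0_mem⟩ = 0 := by
  simp only [derivFun, symB, projB, stokesA, Pi.sub_apply, Pi.neg_apply, Pi.add_apply, Pi.smul_apply,
    zero_smul, sub_zero, W0_k0, smul_zero, neg_zero, zero_sub, neg_eq_zero]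
  rw [cc_W0_any_k0, cc_any_W0_k0, leraySym_zero, add_zero]

/-- `(W₀, 0) ∈ V_2(g)` (the point `s = 0` of the line). -/
theorem W0_mem_variety : (W0, (0 : ℝ)) ∈ variety (PB 2) gW := by
  have := line_mem_variety 0
  rwa [zero_smul, zero_add] at this

/-- **The witness force of §5 is NOT a regular value**: `U₀ ∈ galerkinSubspace` has `(U₀)_{k₀} = e₀ ≠ 0`
but every `DF(W₀,0)(v,t)` has zero `k₀`-coefficient.  So the `ν = 0`-line mechanism is exactly what
the regularity hypothesis excludes; it cannot be recycled against the crux as stated. -/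
theorem not_regular_gW : ¬ Regular (PB 2) gW := by
  intro hreg
  rw [regular_iff] at hreg
  obtain ⟨v, _, t, hvt⟩ := hreg _ W0_mem_variety U0 U0_mem
  have h1 := congrFun hvt ⟨k0, k0_mem⟩
  rw [derivFun_W0_k0, U0_apply, if_pos (Or.inl rfl)] at h1
  have : ‖aU‖ = 0 := by rw [← h1, norm_zero]
  rw [norm_aU] at this
  exact one_ne_zero this


/-! ## §10 Dead slots on the `ν = 0` fibre (criticality criterion); helicity conservation of the truncation

The obstruction behind `not_regular_gW` in general form: at a point `(c, 0)` of the `ν = 0` fibre, a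
frequency `k ∈ S` with `c_k = 0` that NO supported frequency of `c` can reach inside `S` (`k - l ∉ S` for
all `l ∈ supp c`) is a DEAD SLOT — every `DF(c,0)(v,t)` vanishes there — so `(c, 0)` is a critical point as
soon as the Galerkin space has an element with nonzero `k`-coefficient (always, for `S = S_N`).  This covers
the earlier route-review witness as well (the 2½-D shear family `(0, cos 2πx₁, s cos 2πx₁ + sin 2πx₂)` of the
13:39Z note on the item: `supp c ⊂ {k₃ = 0}`, so the top slot `(0,0,N)` is dead at EVERY `N ≥ 2`): ALL
`ν = 0` lines built from low/planar modes are critical, at every resolution.  Unbounded `ν = 0` fibres of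
REGULAR forces, if any, need supports reaching every shell. -/

/-- **Dead slots at `ν = 0`**: if `c_k = 0` and no supported frequency `l` of `c` has `k - l ∈ S`, then every
`DF(c, 0)(v, t)` has zero `k`-coefficient. [folklore] -/
theorem derivFun_apply_eq_zero_of_unreachable {S : Finset (Fin 3 → ℤ)} {c : ↥S → (EuclideanSpace ℂ (Fin 3))} {k : ↥S}
    (hck : c k = 0) (hreach : ∀ l ∈ S, coeffExt S c l ≠ 0 → (k : Fin 3 → ℤ) - l ∉ S)
    (h : (↥S → (EuclideanSpace ℂ (Fin 3))) × ℝ) : derivFun S (c, (0 : ℝ)) h k = 0 := by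
  have h1 : convectionCoeff S (coeffExt S c) (coeffExt S h.1) k = 0 :=
    convectionCoeff_eq_zero_of_support fun l hl m hm hcl _ heq => hreach l hl hcl (by
      have hm' : (k : Fin 3 → ℤ) - l = m := by rw [← heq]; abel
      rw [hm']; exact hm)
  have h2 : convectionCoeff S (coeffExt S h.1) (coeffExt S c) k = 0 :=
    convectionCoeff_eq_zero_of_support fun l hl m hm _ hcm heq => hreach m hm hcm (by
      have hl' : (k : Fin 3 → ℤ) - m = l := by rw [← heq]; abel
      rw [hl']; exact hl)
  simp only [derivFun, symB, projB, stokesA, Pi.sub_apply, Pi.neg_apply, Pi.add_apply, Pi.smul_apply,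
    zero_smul, sub_zero, hck, smul_zero, neg_zero, h1, h2, leraySym_zero, add_zero]

/-- **Criticality criterion on the `ν = 0` fibre**: a zero `(c, 0)` with a dead slot `k` at which the
Galerkin space is nontrivial is a CRITICAL point of `F` — the force is not a regular value. [folklore] -/
theorem not_regular_of_dead_slot {S : Finset (Fin 3 → ℤ)} {g c : ↥S → (EuclideanSpace ℂ (Fin 3))} {k : ↥S}
    (hc : ((c, (0 : ℝ)) : (↥S → (EuclideanSpace ℂ (Fin 3))) × ℝ) ∈ variety S g) (hck : c k = 0)
    (hreach : ∀ l ∈ S, coeffExt S c l ≠ 0 → (k : Fin 3 → ℤ) - l ∉ S)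
    (hw : ∃ w ∈ galerkinSubspace S, w k ≠ 0) : ¬ Regular S g := by
  intro hreg
  rw [regular_iff] at hreg
  obtain ⟨w, hwm, hwk⟩ := hw
  obtain ⟨v, _, t, hvt⟩ := hreg _ hc w hwm
  have := congrFun hvt k
  rw [derivFun_apply_eq_zero_of_unreachable hck hreach] at this
  exact hwk this.symm


end Summit.AnomalousDissipation.AnomalousDissipation.Theorems.GenericRunawayStokesScaling.Negative
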